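import Literature.Probability.Percolation.BoxGatewayRarity
import HarnessLib

/-!
# `stub_noLRO_K1` of line `registered` (crux `PercFiniteBoxLRO.RenormaliseFromLinearLRO`,
# stmt-CriticalPhenomena-0857, reshape 2): no linear-scale finite-box LRO at `p_c(ℤ³)` with `K = 1`

Registered stub `stub_noLRO_K1` of the lead's skeleton: the boundary case `K = 1` of
"no linear-scale finite-box long-range order at `p_c(ℤ³)`",
`¬ ∃ ρ > 0, ∀ n ≥ 1, ∀ x y ∈ Λ(n), ρ ≤ P_{p_c}(x ↔ y inside Λ(1 · n))`.

Proof (Barsky–Grimmett–Newman).  `θ_ℍ(p_c(ℤ³)) = 0` is PROVED in the tree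
(`BarskyGrimmettNewman1991_Z3_holds`), whence `P_{p_c}(A_t) → 0` for the half-space events
`A_t = {0 ↔ height ≥ t inside ℍ}` (`CerfDembinVanishing.tendsto_measure_halfSpaceReach`); pick `n ≥ 1`
with `P_{p_c}(A_n) < ρ`.  The face vertex `w = n e₀` lies on `∂ⁱⁿΛ(n)` and the centre `0` lies in
`Λ(n - n)`, so `P_{p_c}(w ↔ 0 inside Λ(n)) ≤ P_{p_c}(A_n)`
(`BoxGateway.real_openConnVia_box_le_halfSpaceReach`, the lattice symmetry of Cerf–Dembin §2 (eq1)),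
after identifying the tree's two "inside `Λ(n)`" events almost surely (`openConnIn_ae_eq_openConnVia`);
the hypothesis at the pair `(w, 0)` gives `ρ ≤ P_{p_c}(w ↔ 0 inside Λ(n)) < ρ`.

Sources: D. J. Barsky, G. R. Grimmett, C. M. Newman, PTRF 90 (1991); G. Grimmett, *Percolation*,
2nd ed. (1999), Thm. (7.35); R. Cerf, B. Dembin, ECP 25 (2020), §2.
-/

noncomputable section

namespace Summit.CriticalPhenomena.PercolationContinuityZ3.Theorems.RenormaliseFromLinearLRO

open Literature.Probability.Percolation Literature.Probability.LatticeModels MeasureTheory Filter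
open scoped Topology

/-- `P_{p_c}(A_t) → 0` on `ℤ³` in real-valued form: Barsky–Grimmett–Newman `θ_ℍ(p_c) = 0`
(`BarskyGrimmettNewman1991_Z3_holds`) fed into `CerfDembinVanishing.tendsto_measure_halfSpaceReach`. -/
theorem noLRO_K1_tendsto_real_halfSpaceReach :
    Tendsto (fun t => (bondPercolation (zdGraph 3) (criticalProbI 3)).real
      (CerfDembinVanishing.halfSpaceReach 3 t)) atTop (𝓝 0) := by
  have h' : Tendsto (fun t => ((bondPercolation (zdGraph 3) (criticalProbI 3))
      (CerfDembinVanishing.halfSpaceReach 3 t)).toReal) atTop (𝓝 (0 : ENNReal).toReal) :=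
    (ENNReal.tendsto_toReal ENNReal.zero_ne_top).comp
      (CerfDembinVanishing.tendsto_measure_halfSpaceReach (criticalProbI 3)
        BarskyGrimmettNewman1991_Z3_holds)
  rw [ENNReal.toReal_zero] at h'
  simpa only [measureReal_def] using h'

/-- **Stub B of line `registered` — the boundary case `K = 1` (Barsky–Grimmett–Newman).**  There is no
`ρ > 0` with `P_{p_c}(x ↔ y inside Λ(n)) ≥ ρ` for all `n ≥ 1` and all `x, y ∈ Λ(n)`: the pair
`(n e₀, 0)` would give `ρ ≤ P_{p_c}(n e₀ ↔ 0 inside Λ(n)) ≤ P_{p_c}(0 ↔ height ≥ n inside ℍ) → 0`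
(the face vertex `n e₀ ∈ ∂ⁱⁿΛ(n)`, cf. `LinearScaleLROReduction.single_mem_innerBoundary`). -/
theorem stub_noLRO_K1 :
    ¬ (∃ ρ : ℝ, 0 < ρ ∧ ∀ n : ℕ, 1 ≤ n → ∀ x ∈ box 3 n, ∀ y ∈ box 3 n,
        ρ ≤ (bondPercolation (zdGraph 3) (criticalProbI 3)).real (openConnIn ↑(box 3 (1 * n)) x y)) := by
  rintro ⟨ρ, hρ, h⟩
  obtain ⟨T, hT⟩ := (Metric.tendsto_atTop.1 noLRO_K1_tendsto_real_halfSpaceReach) ρ hρ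
  set n : ℕ := max T 1 with hn
  have hn1 : 1 ≤ n := le_max_right _ _
  have hTn : T ≤ n := le_max_left _ _
  have hsmall : (bondPercolation (zdGraph 3) (criticalProbI 3)).real
      (CerfDembinVanishing.halfSpaceReach 3 n) < ρ := by
    have := hT n hTn
    rwa [Real.dist_eq, sub_zero, abs_of_nonneg measureReal_nonneg] at this
  -- the face vertex `w = n e₀ ∈ ∂ⁱⁿΛ(n)` and the centre `0 ∈ Λ(n - n)`
  set w : Site 3 := Pi.single 0 (n : ℤ) with hw
  have hwbox : w ∈ box 3 n := by
    rw [mem_box]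
    intro i
    rcases eq_or_ne i 0 with rfl | hi
    · simp [hw]
    · simp [hw, Pi.single_eq_of_ne hi]
  have hwbd : w ∈ innerBoundary (zdGraph 3) (box 3 n) :=
    DCT16.mem_innerBoundary_box_of_natAbs_eq hwbox (i := 0) (by simp [hw])
  have hx : (0 : Site 3) ∈ box 3 (n - n) := zero_mem_box 3 (n - n)
  -- the hypothesis at the pair `(w, 0)`, in the `openConnVia` vocabulary
  have hle := h n hn1 w hwbox 0 (zero_mem_box 3 n)
  rw [one_mul] at hle
  have heq : (bondPercolation (zdGraph 3) (criticalProbI 3)).real (openConnIn ↑(box 3 n) w 0) =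
      (bondPercolation (zdGraph 3) (criticalProbI 3)).real
        (openConnVia (withinGraph (zdGraph 3) ↑(box 3 n)) w 0) :=
    measureReal_congr
      (openConnIn_ae_eq_openConnVia (G := zdGraph 3) (criticalProbI 3) (Finset.mem_coe.2 hwbox) 0)
  -- the half-space bound
  have hbd := BoxGateway.real_openConnVia_box_le_halfSpaceReach (criticalProbI 3) hwbd hx le_rfl
  linarith

end Summit.CriticalPhenomena.PercolationContinuityZ3.Theorems.RenormaliseFromLinearLRO

end
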